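import Literature.Probability.Independence.BerryEsseenMajorant
import HarnessLib

/-!
# Berry–Esseen from a characteristic-function majorant with an INNER WINDOW (model-free)

Topic `Literature/Probability/Independence` (continues `BerryEsseenMajorant.lean`: a majorant `|θ|e^{−θ²/4}(A + Bθ²)` of `‖φ_μ(θ) − e^{−θ²/2}‖` on
`|θ| < L` bounds the Kolmogorov distance to `𝒩(0,1)` by `(2A + 4B)/√π + 48/(5πL)`).  When the majorant comes from complex two-term asymptotics of a
partition function (transfer-matrix statistics), the geometric remainders are small UNIFORMLY in `θ` but not `O(θ)` at `θ = 0`, so the Gaussian-weighted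
majorant is only available for `τ ≤ |θ| < L` with a tiny `τ` (e.g. `τ = 1/√N`); on the inner window `|θ| ≤ τ` the trivial first-moment bound
`‖φ_μ(θ) − 1‖ ≤ |θ|·∫|x|dμ` suffices because the window is short.  THIS FILE records that two-window form with explicit constants:

* §1 `norm_charFun_sub_one_le` — `‖φ_μ(θ) − 1‖ ≤ |θ|·∫|x| dμ` (first absolute moment; `|e^{ia} − 1| ≤ |a|`);
  `norm_charFun_sub_gauss_le_linear` — hence `‖φ_μ(θ) − e^{−θ²/2}‖ ≤ (∫|x|dμ + 1/2)·|θ|` for `|θ| ≤ 1`.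
* §2 ★★ `abs_cdf_sub_gaussian_le_of_two_windows` — if `‖φ_μ(θ) − e^{−θ²/2}‖ ≤ A₁|θ|` for `|θ| ≤ τ` and `≤ |θ|e^{−θ²/4}(A + Bθ²)` for `τ < |θ| < L`
  (`0 ≤ τ`, `0 < L`, `A₁, A, B ≥ 0`), then for every `x`: `|μ(−∞,x] − 𝒩(0,1)(−∞,x]| ≤ (2τA₁ + (2A + 4B)√π)/π + 48/(5πL)`.
* §3 ★★ `abs_cdf_sub_gaussian_le_rate_two_windows` — the RATE form along a family `μ_n` with inner window `τ_n = c/r_n`, outer majorant constants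
  `a/r_n`, `b/r_n` on `τ_n < |θ| < δ r_n`: `sup_x |μ_n(−∞,x] − 𝒩(−∞,x]| ≤ ((2cA₁ + (2a+4b)√π)/π + 48/(5πδ))/r_n`.

## Sources
R. Durrett, *Probability: Theory and Examples* (2019) §3.4.4, display (3.4.1) and the proof of Theorem 3.4.17; W. Feller II (1971) XVI.5 Lemma 2; for the
first-moment bound §3.3 (3.3.3).  The two-window formulation and constants are this lineage's (lane «pcv-sawmu», a-p5 g28); nothing is quoted AS PRINTED.
-/

noncomputable section

open MeasureTheory ProbabilityTheory Filter Complex Set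
open Literature.Probability.Distributions
open scoped Topology Real ENNReal

namespace Literature.Probability.Independence

variable {μ : Measure ℝ}

/-! ## §1 The first-moment bound on the inner window -/

/-- **`‖φ_μ(θ) − 1‖ ≤ |θ|·∫|x| dμ`** for a probability measure with a first absolute moment (`|e^{iθx} − 1| ≤ |θx|`).
[cite: Durrett2019, §3.3 Theorem 3.3.1 and display (3.3.3) (lane statement: the first-order case)] -/
theorem norm_charFun_sub_one_le [IsProbabilityMeasure μ] (hμ : Integrable (fun x : ℝ => x) μ) (θ : ℝ) :
    ‖charFun μ θ - 1‖ ≤ |θ| * ∫ x, |x| ∂μ := by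
  have hint : Integrable (fun x : ℝ => cexp ((θ : ℂ) * (x : ℂ) * I)) μ := by
    refine Integrable.mono' (integrable_const (1 : ℝ)) (by fun_prop) (ae_of_all _ fun x => ?_)
    rw [show (θ : ℂ) * (x : ℂ) * I = ((θ * x : ℝ) : ℂ) * I by push_cast; ring, Complex.norm_exp_ofReal_mul_I]
  have h1 : charFun μ θ - 1 = ∫ x, (cexp ((θ : ℂ) * (x : ℂ) * I) - 1) ∂μ := by
    rw [charFun_apply_real, integral_sub hint (integrable_const _), integral_const]
    simp
  rw [h1, ← integral_const_mul]
  refine (norm_integral_le_integral_norm _).trans (integral_mono_of_nonneg (ae_of_all _ fun x => norm_nonneg _)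
    (hμ.abs.const_mul _) (ae_of_all _ fun x => ?_))
  have h := Real.norm_exp_I_mul_ofReal_sub_one_le (x := θ * x)
  rw [show I * ((θ * x : ℝ) : ℂ) = (θ : ℂ) * (x : ℂ) * I by push_cast; ring] at h
  simpa [Real.norm_eq_abs, abs_mul] using h

/-- **Inner-window majorant**: for `|θ| ≤ 1`, `‖φ_μ(θ) − e^{−θ²/2}‖ ≤ (∫|x| dμ + 1/2)·|θ|` (`|1 − e^{−θ²/2}| ≤ θ²/2 ≤ |θ|/2`).
[cite: Durrett2019, §3.3 display (3.3.3) (lane corollary)] -/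
theorem norm_charFun_sub_gauss_le_linear [IsProbabilityMeasure μ] (hμ : Integrable (fun x : ℝ => x) μ) {θ : ℝ} (hθ : |θ| ≤ 1) :
    ‖charFun μ θ - cexp (-((θ : ℂ) ^ 2 / 2))‖ ≤ (∫ x, |x| ∂μ + 1 / 2) * |θ| := by
  have h1 := norm_charFun_sub_one_le (μ := μ) hμ θ
  have h2 : ‖(1 : ℂ) - cexp (-((θ : ℂ) ^ 2 / 2))‖ ≤ θ ^ 2 / 2 := by
    rw [show (-((θ : ℂ) ^ 2 / 2)) = ((-(θ ^ 2 / 2) : ℝ) : ℂ) by push_cast; ring, ← Complex.ofReal_one, ← Complex.ofReal_exp,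
      ← Complex.ofReal_sub, Complex.norm_real, Real.norm_eq_abs, abs_of_nonneg (by
        have : Real.exp (-(θ ^ 2 / 2)) ≤ 1 := Real.exp_le_one_iff.2 (by nlinarith [sq_nonneg θ]); linarith)]
    have h := Real.add_one_le_exp (-(θ ^ 2 / 2))
    linarith
  have hθ2 : θ ^ 2 ≤ |θ| := by
    rw [← sq_abs]; nlinarith [abs_nonneg θ]
  calc ‖charFun μ θ - cexp (-((θ : ℂ) ^ 2 / 2))‖
      = ‖(charFun μ θ - 1) + (1 - cexp (-((θ : ℂ) ^ 2 / 2)))‖ := by ring_nf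
    _ ≤ ‖charFun μ θ - 1‖ + ‖(1 : ℂ) - cexp (-((θ : ℂ) ^ 2 / 2))‖ := norm_add_le _ _
    _ ≤ |θ| * ∫ x, |x| ∂μ + θ ^ 2 / 2 := add_le_add h1 h2
    _ ≤ (∫ x, |x| ∂μ + 1 / 2) * |θ| := by nlinarith [integral_nonneg (μ := μ) (f := fun x : ℝ => |x|) fun x => abs_nonneg x]

/-! ## §2 ★★ The two-window smoothing bound -/

/-- The integrable two-window dominating function `e^{−θ²/4}(A + Bθ²) + A₁·𝟙_{[−τ,τ]}` and its integral `(2A+4B)√π + 2τA₁`.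
[cite: Durrett2019, proof of Theorem 3.4.17 (lane plumbing)] -/
theorem integral_twoWindow_majorant {τ A₁ : ℝ} (hτ : 0 ≤ τ) (A B : ℝ) :
    Integrable (fun θ : ℝ => Real.exp (-θ ^ 2 / 4) * (A + B * θ ^ 2) + (Icc (-τ) τ).indicator (fun _ => A₁) θ) ∧
    ∫ θ : ℝ, (Real.exp (-θ ^ 2 / 4) * (A + B * θ ^ 2) + (Icc (-τ) τ).indicator (fun _ => A₁) θ) = (2 * A + 4 * B) * √π + 2 * τ * A₁ := by
  have hI' : Integrable (fun θ : ℝ => (Icc (-τ) τ).indicator (fun _ => A₁) θ) := by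
    refine (integrableOn_const (C := A₁) (s := Icc (-τ) τ) ?_).integrable_indicator measurableSet_Icc
    simp [Real.volume_Icc]
  refine ⟨(integrable_exp_mul_affine_sq A B).add hI', ?_⟩
  rw [integral_add (integrable_exp_mul_affine_sq A B) hI', integral_exp_mul_affine_sq, integral_indicator measurableSet_Icc,
    setIntegral_const, Real.volume_real_Icc_of_le (by linarith), smul_eq_mul]
  ring

/-- ★★ **BERRY–ESSEEN FROM A TWO-WINDOW MAJORANT (model-free).**  Let `μ` be a probability measure on `ℝ`, `0 ≤ τ`, `0 < L`, `A₁, A, B ≥ 0`, and suppose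
`‖φ_μ(θ) − e^{−θ²/2}‖ ≤ A₁|θ|` for `|θ| ≤ τ` and `‖φ_μ(θ) − e^{−θ²/2}‖ ≤ |θ|e^{−θ²/4}(A + Bθ²)` for `τ < |θ| < L`.  Then for every real `x`,
`|μ(−∞,x] − 𝒩(0,1)(−∞,x]| ≤ (2τA₁ + (2A + 4B)√π)/π + 48/(5πL)` (Durrett's smoothing inequality (3.4.1) with Pólya's kernel at frequency `L`, `λ = 2/5`,
the kernel dominated by `e^{−θ²/4}(A + Bθ²) + A₁𝟙_{[−τ,τ]}`).
[cite: Durrett2019, §3.4.4 display (3.4.1) and proof of Theorem 3.4.17 (lane statement with an inner window); Feller1971, XVI.5 Lemma 2] -/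
theorem abs_cdf_sub_gaussian_le_of_two_windows [IsProbabilityMeasure μ] {τ L A₁ A B : ℝ} (hτ : 0 ≤ τ) (hL : 0 < L)
    (hA₁ : 0 ≤ A₁) (hA : 0 ≤ A) (hB : 0 ≤ B)
    (hφ₁ : ∀ θ : ℝ, |θ| ≤ τ → ‖charFun μ θ - cexp (-((θ : ℂ) ^ 2 / 2))‖ ≤ A₁ * |θ|)
    (hφ₂ : ∀ θ : ℝ, τ < |θ| → |θ| < L → ‖charFun μ θ - cexp (-((θ : ℂ) ^ 2 / 2))‖ ≤ |θ| * Real.exp (-θ ^ 2 / 4) * (A + B * θ ^ 2))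
    (x : ℝ) :
    |μ.real (Iic x) - (gaussianReal 0 1).real (Iic x)| ≤ (2 * τ * A₁ + (2 * A + 4 * B) * √π) / π + 48 / (5 * π * L) := by
  -- pointwise domination of the smoothing kernel by the two-window majorant
  have hgb : ∀ θ : ℝ, ‖((max (1 - |θ / L|) 0 : ℝ) : ℂ) * (charFun μ θ - charFun (gaussianReal 0 1) θ) / ((θ : ℂ) * I)‖
      ≤ Real.exp (-θ ^ 2 / 4) * (A + B * θ ^ 2) + (Icc (-τ) τ).indicator (fun _ => A₁) θ := by
    intro θ
    have hG0 : 0 ≤ Real.exp (-θ ^ 2 / 4) * (A + B * θ ^ 2) := by positivity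
    have hI0 : 0 ≤ (Icc (-τ) τ).indicator (fun _ => A₁) θ := Set.indicator_nonneg (fun _ _ => hA₁) _
    rcases eq_or_ne θ 0 with rfl | hθ0
    · simp only [Complex.ofReal_zero, zero_mul, div_zero, norm_zero]; positivity
    by_cases hθL : L ≤ |θ|
    · rw [triangle_div_eq_zero hL hθL]
      simp only [Complex.ofReal_zero, zero_mul, zero_div, norm_zero]; positivity
    have hθL' : |θ| < L := lt_of_not_ge hθL
    have hθa : 0 < |θ| := abs_pos.2 hθ0
    have hω0 : 0 ≤ max (1 - |θ / L|) 0 := le_max_right _ _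
    have hω1 : max (1 - |θ / L|) 0 ≤ 1 := triangle_div_le_one L θ
    rw [charFun_gaussianReal_zero_one, norm_div, norm_mul, norm_mul, Complex.norm_real, Complex.norm_real, norm_I, mul_one,
      Real.norm_of_nonneg hω0, Real.norm_eq_abs, div_le_iff₀ hθa]
    have hker : ‖charFun μ θ - cexp (-((θ : ℂ) ^ 2 / 2))‖
        ≤ (Real.exp (-θ ^ 2 / 4) * (A + B * θ ^ 2) + (Icc (-τ) τ).indicator (fun _ => A₁) θ) * |θ| := by
      by_cases hθτ : |θ| ≤ τ
      · have hmem : θ ∈ Icc (-τ) τ := ⟨by linarith [neg_abs_le θ], le_trans (le_abs_self θ) hθτ⟩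
        rw [Set.indicator_of_mem hmem]
        calc ‖charFun μ θ - cexp (-((θ : ℂ) ^ 2 / 2))‖ ≤ A₁ * |θ| := hφ₁ θ hθτ
          _ ≤ (Real.exp (-θ ^ 2 / 4) * (A + B * θ ^ 2) + A₁) * |θ| := by nlinarith
      · have h := hφ₂ θ (lt_of_not_ge hθτ) hθL'
        calc ‖charFun μ θ - cexp (-((θ : ℂ) ^ 2 / 2))‖ ≤ |θ| * Real.exp (-θ ^ 2 / 4) * (A + B * θ ^ 2) := h
          _ ≤ (Real.exp (-θ ^ 2 / 4) * (A + B * θ ^ 2) + (Icc (-τ) τ).indicator (fun _ => A₁) θ) * |θ| := by nlinarith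
    calc max (1 - |θ / L|) 0 * ‖charFun μ θ - cexp (-((θ : ℂ) ^ 2 / 2))‖
        ≤ 1 * ((Real.exp (-θ ^ 2 / 4) * (A + B * θ ^ 2) + (Icc (-τ) τ).indicator (fun _ => A₁) θ) * |θ|) :=
          mul_le_mul hω1 hker (norm_nonneg _) zero_le_one
      _ = (Real.exp (-θ ^ 2 / 4) * (A + B * θ ^ 2) + (Icc (-τ) τ).indicator (fun _ => A₁) θ) * |θ| := one_mul _
  obtain ⟨hMi, hMint⟩ := integral_twoWindow_majorant (A₁ := A₁) hτ A B
  have hgm : AEStronglyMeasurable (fun θ : ℝ => ((max (1 - |θ / L|) 0 : ℝ) : ℂ) *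
      (charFun μ θ - charFun (gaussianReal 0 1) θ) / ((θ : ℂ) * I)) volume := by
    refine Measurable.aestronglyMeasurable ?_
    exact ((continuous_ofReal.comp (continuous_triangle_div L)).measurable.mul
      (measurable_charFun.sub measurable_charFun)).div (by fun_prop)
  have hgi : Integrable (fun θ : ℝ => ((max (1 - |θ / L|) 0 : ℝ) : ℂ) *
      (charFun μ θ - charFun (gaussianReal 0 1) θ) / ((θ : ℂ) * I)) :=
    Integrable.mono' hMi hgm (ae_of_all _ hgb)
  have hK : ∫ θ : ℝ, ‖((max (1 - |θ / L|) 0 : ℝ) : ℂ) *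
      (charFun μ θ - charFun (gaussianReal 0 1) θ) / ((θ : ℂ) * I)‖ ≤ (2 * A + 4 * B) * √π + 2 * τ * A₁ := by
    rw [← hMint]
    exact integral_mono hgi.norm hMi hgb
  have h341 := Durrett2019_eq_3_4_1 (μ := μ) (ν := gaussianReal 0 1) hL
    (by norm_num : (0 : ℝ) < 2 / 5) abs_gaussianReal_real_Iic_sub_le hgi x
  refine h341.trans ?_
  have hπ := Real.pi_pos
  calc π⁻¹ * (∫ θ : ℝ, ‖((max (1 - |θ / L|) 0 : ℝ) : ℂ) *
        (charFun μ θ - charFun (gaussianReal 0 1) θ) / ((θ : ℂ) * I)‖) + 24 * (2 / 5) / (π * L)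
      ≤ π⁻¹ * ((2 * A + 4 * B) * √π + 2 * τ * A₁) + 24 * (2 / 5) / (π * L) := by gcongr
    _ = (2 * τ * A₁ + (2 * A + 4 * B) * √π) / π + 48 / (5 * π * L) := by
        field_simp
        ring

/-! ## §3 ★★ The rate form along a family -/

/-- ★★ **BERRY–ESSEEN RATE WITH AN INNER WINDOW.**  Let `μ_n` be probability measures on `ℝ`, `r_n > 0`, `δ > 0`, `c, A₁, a, b ≥ 0`, and suppose that for
every `n`: `‖φ_{μ_n}(θ) − e^{−θ²/2}‖ ≤ A₁|θ|` whenever `|θ| ≤ c/r_n`, and `‖φ_{μ_n}(θ) − e^{−θ²/2}‖ ≤ |θ|e^{−θ²/4}(a + bθ²)/r_n` whenever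
`c/r_n < |θ| < δ r_n`.  Then for every `n` and `x`: `|μ_n(−∞,x] − 𝒩(0,1)(−∞,x]| ≤ ((2cA₁ + (2a + 4b)√π)/π + 48/(5πδ))/r_n`.
[cite: Durrett2019, §3.4.4 Theorem 3.4.17 (lane statement: rate form with an inner window); Feller1971, XVI.5] -/
theorem abs_cdf_sub_gaussian_le_rate_two_windows {α : Type*} {μs : α → Measure ℝ} [∀ n, IsProbabilityMeasure (μs n)] {r : α → ℝ}
    {δ c A₁ a b : ℝ} (hδ : 0 < δ) (hc : 0 ≤ c) (hA₁ : 0 ≤ A₁) (ha : 0 ≤ a) (hb : 0 ≤ b) (hr : ∀ n, 0 < r n)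
    (hφ₁ : ∀ n, ∀ θ : ℝ, |θ| ≤ c / r n → ‖charFun (μs n) θ - cexp (-((θ : ℂ) ^ 2 / 2))‖ ≤ A₁ * |θ|)
    (hφ₂ : ∀ n, ∀ θ : ℝ, c / r n < |θ| → |θ| < δ * r n →
      ‖charFun (μs n) θ - cexp (-((θ : ℂ) ^ 2 / 2))‖ ≤ |θ| * Real.exp (-θ ^ 2 / 4) * (a + b * θ ^ 2) / r n)
    (n : α) (x : ℝ) :
    |(μs n).real (Iic x) - (gaussianReal 0 1).real (Iic x)| ≤ ((2 * c * A₁ + (2 * a + 4 * b) * √π) / π + 48 / (5 * π * δ)) / r n := by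
  have hrn := hr n
  have h := abs_cdf_sub_gaussian_le_of_two_windows (μ := μs n) (τ := c / r n) (L := δ * r n) (A₁ := A₁) (A := a / r n) (B := b / r n)
    (by positivity) (by positivity) hA₁ (by positivity) (by positivity) (hφ₁ n) (fun θ h1 h2 => by
      have := hφ₂ n θ h1 h2
      rw [show |θ| * Real.exp (-θ ^ 2 / 4) * (a / r n + b / r n * θ ^ 2)
        = |θ| * Real.exp (-θ ^ 2 / 4) * (a + b * θ ^ 2) / r n by field_simp]
      exact this) x
  refine h.trans (le_of_eq ?_)
  have hπ := Real.pi_pos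
  field_simp

end Literature.Probability.Independence

end
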